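import Literature.NumberTheory.Automorphic.QuadraticOrdersConductors
import Literature.NumberTheory.Automorphic.QuadraticOrderUnits
import Literature.NumberTheory.Automorphic.QuadraticOrderClassNumberIndex
import Literature.NumberTheory.Automorphic.QuaternionAlgebraSplitting
import Literature.NumberTheory.Automorphic.QuaternionAlgebraAdelicReducedNormMulProofs
import HarnessLib

/-!
# The conductor step for weighted class numbers: `h_w(Δ/f²) = h_w(Δ/(fq)²) (q + 1 - ρ_q)`

Topic `NumberTheory/Automorphic`; definitions and theorems only (no named fact, no `sorry`).
Thirteenth brick of the Brandt-module side of the Eichler–Pizer trace identity: the one-prime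
step of **Cox Thm. 7.24 with units**, in the weighted form used by the Eichler–Selberg trace
formula. For `t² < 4n`, a prime `q` and conductors `f ∣ fq` of `(t, n)`
(`ellipticConductors t n`),

`h_w((t² - 4n)/f²) = h_w((t² - 4n)/(fq)²) · (q + 1 - ρ_q(t_{fq}, n_{fq}))`

(`weightedClassNumber_step`), where `ρ_q(t', n') = #{x mod q : x² - t'x + n' ≡ 0}` is `1` if
`B_{fq}` is not maximal at `q` and `1 + (disc B_{fq} / q)` otherwise, and
`h_w = 2 h / w` (`weightedClassNumber_eq`).  Proof: realise `ℚ(√(t² - 4n))` inside the definite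
quaternion algebra `ℍ[ℚ, t² - 4n, -1]` by `γ = (t + i)/2`; there the orders `B_f ⊂ B_{fq}`
through `γ` are a `StepHyp` step, the idelic class number formula
(`classNumber_mul_relIndex_eq`, `StepHyp.relIndex_eq`) gives
`h(B_f) [B_{fq}ˣ : B_fˣ] = h(B_{fq}) (q + 1 - ρ_q)`, and `h(B) = h(disc B)`, `#Bˣ = w(disc B)`
(`PicHyp.classNumber_eq`, `PicHyp.card_units_eq`).

## References

* D. A. Cox, *Primes of the form x² + ny²*, 2nd ed. (2013), Thm. 7.24 and Cor. 7.28, [Cox2013].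
* M.-F. Vignéras, *Arithmétique des algèbres de quaternions*, LNM 800 (1980), Ch. III §5
  Cor. 5.12, [VignerasLNM800].
-/

noncomputable section

open scoped Pointwise Quaternion

universe u

namespace Literature.NumberTheory.Automorphic

open HeckeTraceFormulaGL2Level Literature.NumberTheory.QuadraticFields.Quadratic

namespace Brandt

/-! ### `w(Δ)` and `h_w = 2h/w` -/

/-- **`w(Δ)`**, the number of units of the imaginary quadratic order of discriminant `Δ`:
`6, 4, 2` for `Δ = -3, -4`, otherwise. [cite: Cox2013, §7.A (units of orders)] -/
def unitsOfDisc (Δ : ℤ) : ℕ := if Δ = -3 then 6 else if Δ = -4 then 4 else 2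

/-- `w(Δ) > 0`. [folklore] -/
theorem unitsOfDisc_pos (Δ : ℤ) : 0 < unitsOfDisc Δ := by
  unfold unitsOfDisc; split_ifs <;> norm_num

/-- **`h_w(Δ) = 2 h(Δ) / w(Δ)`** (`h(-3) = h(-4) = 1`). [cite: SchoofVandervlugt1991, Prop. 2.1, p. 165; Cox2013, Thm. 7.30] -/
theorem weightedClassNumber_eq (Δ : ℤ) :
    weightedClassNumber Δ = 2 * (BinQF.classNumber Δ : ℚ) / unitsOfDisc Δ := by
  unfold weightedClassNumber unitsOfDisc
  split_ifs with h3 h4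
  · rw [h3, BinQF.classNumber_eq_one_of_mem_classNumberOneDiscrs (by decide)]; norm_num
  · rw [h4, BinQF.classNumber_eq_one_of_mem_classNumberOneDiscrs (by decide)]; norm_num
  · norm_num

/-! ### The step inside a division quaternion algebra -/

section Generic

variable {D : Type u} [Ring D] [Algebra ℚ D] [IsQuaternionAlgebra ℚ D] {γ : D} {t : ℤ} {n : ℕ}

omit [IsQuaternionAlgebra ℚ D] [Algebra ℚ D] in
/-- For `H ≤ K` finite, `|H| · [K : H] = |K|`. [folklore] -/
theorem card_mul_relIndex_of_le {G : Type*} [Group G] {H K : Subgroup G} (hle : H ≤ K) :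
    Nat.card H * H.relIndex K = Nat.card K := by
  rw [Subgroup.relIndex, ← Nat.card_congr (Subgroup.subgroupOfEquivOfLe hle).toEquiv]
  exact Subgroup.card_mul_index _

omit [IsQuaternionAlgebra ℚ D] in
/-- The optimal order of an order `B` of `ℚ(γ)` is `B` itself. [folklore] -/
theorem optimalOrder_eq_self {B : Submodule ℤ D} (hB : IsQuadOrder γ B) : optimalOrder B γ = B := by
  unfold optimalOrder
  rw [leftOrder_eq_self_of_one_mem hB.one_mem hB.mul_mem]
  exact inf_eq_left.mpr hB.le_adjoin

namespace GammaHyp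

variable (H : GammaHyp γ t n)
include H

/-- **`|Stab(B_f) ∩ ℚ(γ)ˣ| = w(disc B_f)`.** [cite: Cox2013, §7.A (units of orders); VignerasLNM800, Ch. V §2 (w(B))] -/
theorem card_stabCentralizer_ordOf {f : ℕ} (hf : f ∈ ellipticConductors t n) :
    Nat.card (stabCentralizer (ordOf γ t n f) γ) = unitsOfDisc (tOf t n f ^ 2 - 4 * nOf t n f) := by
  rw [card_stabCentralizer_eq_card_units H.hdiv H.hγ, optimalOrder_eq_self (H.isQuadOrder_ordOf hf),
    (H.picHyp_ordOf hf).card_units_eq, unitsOfDisc]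

/-- **`h(B_f) = h(disc B_f)`.** [cite: Cox2013, Thm. 7.7] -/
theorem classNumber_ordOf {f : ℕ} (hf : f ∈ ellipticConductors t n) :
    classNumber γ (ordOf γ t n f) = BinQF.classNumber (tOf t n f ^ 2 - 4 * nOf t n f) :=
  (H.picHyp_ordOf hf).classNumber_eq

/-- **The conductor step** (Cox Thm. 7.24 for one prime, with units):
`h(B_f) · w(B_{fq}) = h(B_{fq}) · (q + 1 - ρ_q(t_{fq}, n_{fq})) · w(B_f)`. [cite: Cox2013, Thm. 7.24; VignerasLNM800, Ch. III §5 Cor. 5.12] -/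
theorem classNumber_step {f q : ℕ} (hq : q.Prime) (hfq : f * q ∈ ellipticConductors t n) :
    BinQF.classNumber (tOf t n f ^ 2 - 4 * nOf t n f) * unitsOfDisc (tOf t n (f * q) ^ 2 - 4 * nOf t n (f * q)) =
      BinQF.classNumber (tOf t n (f * q) ^ 2 - 4 * nOf t n (f * q)) *
        (q + 1 - rho q (tOf t n (f * q)) (nOf t n (f * q))) * unitsOfDisc (tOf t n f ^ 2 - 4 * nOf t n f) := by
  haveI := Fact.mk hq
  have hf : f ∈ ellipticConductors t n := dvd_mem_ellipticConductors H.hlt hfq (dvd_mul_right f q)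
  have hfq0 : f * q ≠ 0 := (pos_of_mem_ellipticConductors H.hlt hfq).ne'
  have hf0 : f ≠ 0 := (pos_of_mem_ellipticConductors H.hlt hf).ne'
  have hB := H.isQuadOrder_ordOf hf
  have hB' := H.isQuadOrder_ordOf hfq
  have hle : ordOf γ t n f ≤ ordOf γ t n (f * q) := ordOf_mono (dvd_mul_right f q) hfq0
  have hSB : ∀ ℓ : ℕ, ℓ.Prime → ℓ ∉ ({q} : Finset ℕ) → localAt ℓ (ordOf γ t n f) = localAt ℓ (ordOf γ t n (f * q)) := by
    intro ℓ hℓ hℓq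
    rw [Finset.mem_singleton] at hℓq
    refine localAt_ordOf_eq (dvd_mul_right f q) hfq0 hℓ ?_
    rw [Nat.mul_div_cancel_left _ (Nat.pos_of_ne_zero hf0)]
    intro h
    exact hℓq ((Nat.prime_dvd_prime_iff_eq hℓ hq).mp h)
  have hD2 := classNumber_mul_relIndex_eq H.hdiv H.hγ hB hB' hle {q} (by simp [hq]) hSB
  rw [Finset.prod_singleton, (H.stepHyp_ordOf hfq).relIndex_eq, card_filter_add_eq_rho hq.ne_zero] at hD2
  -- the global unit index
  have hidx := card_mul_relIndex_of_le (stabCentralizer_mono hB hB' hle)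
  rw [H.card_stabCentralizer_ordOf hf, H.card_stabCentralizer_ordOf hfq] at hidx
  rw [H.classNumber_ordOf hf, H.classNumber_ordOf hfq] at hD2
  -- combine: `h_f · w_{fq} = h_f · w_f · r = w_f · (h_{fq} · L)`
  calc BinQF.classNumber (tOf t n f ^ 2 - 4 * nOf t n f) * unitsOfDisc (tOf t n (f * q) ^ 2 - 4 * nOf t n (f * q))
      = BinQF.classNumber (tOf t n f ^ 2 - 4 * nOf t n f) *
          (stabCentralizer (ordOf γ t n f) γ).relIndex (stabCentralizer (ordOf γ t n (f * q)) γ) *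
            unitsOfDisc (tOf t n f ^ 2 - 4 * nOf t n f) := by rw [← hidx]; ring
    _ = _ := by rw [hD2]

/-- The conductor step in weighted form, inside `D`. [cite: Cox2013, Thm. 7.24; VignerasLNM800, Ch. III §5 Cor. 5.12] -/
theorem weightedClassNumber_step {f q : ℕ} (hq : q.Prime) (hfq : f * q ∈ ellipticConductors t n) :
    weightedClassNumber ((t ^ 2 - 4 * n) / (f : ℤ) ^ 2) =
      weightedClassNumber ((t ^ 2 - 4 * n) / ((f * q : ℕ) : ℤ) ^ 2) *
        ((q : ℚ) + 1 - rho q (tOf t n (f * q)) (nOf t n (f * q))) := by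
  have hf : f ∈ ellipticConductors t n := dvd_mem_ellipticConductors H.hlt hfq (dvd_mul_right f q)
  rw [disc_div_sq H.hlt hf, disc_div_sq H.hlt hfq, weightedClassNumber_eq, weightedClassNumber_eq]
  have h := H.classNumber_step hq hfq
  have hρ : rho q (tOf t n (f * q)) (nOf t n (f * q)) ≤ q + 1 :=
    (rho_le_two hq _ _).trans (by have := hq.two_le; omega)
  have hw := unitsOfDisc_pos (tOf t n f ^ 2 - 4 * nOf t n f)
  have hw' := unitsOfDisc_pos (tOf t n (f * q) ^ 2 - 4 * nOf t n (f * q))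
  have hQ : (BinQF.classNumber (tOf t n f ^ 2 - 4 * nOf t n f) : ℚ) * unitsOfDisc (tOf t n (f * q) ^ 2 - 4 * nOf t n (f * q)) =
      BinQF.classNumber (tOf t n (f * q) ^ 2 - 4 * nOf t n (f * q)) *
        ((q : ℚ) + 1 - rho q (tOf t n (f * q)) (nOf t n (f * q))) * unitsOfDisc (tOf t n f ^ 2 - 4 * nOf t n f) := by
    have := congrArg (fun x : ℕ => (x : ℚ)) h
    push_cast [hρ] at this
    exact this
  have hwQ : (unitsOfDisc (tOf t n f ^ 2 - 4 * nOf t n f) : ℚ) ≠ 0 := by positivity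
  have hwQ' : (unitsOfDisc (tOf t n (f * q) ^ 2 - 4 * nOf t n (f * q)) : ℚ) ≠ 0 := by positivity
  field_simp
  linear_combination hQ

end GammaHyp

end Generic

/-! ### The universal model `ℍ[ℚ, t² - 4n, -1]` and the arithmetic step -/

section Universal

variable {t : ℤ} {n : ℕ}

/-- **`ℍ[ℚ, Δ, -1]` is a division algebra for `Δ < 0`** (its norm form
`x² - Δy² + z² - Δw²` is positive definite). [cite: VignerasLNM800, Ch. I §1 Lemme 1.1] -/
theorem isUnit_of_ne_zero_of_neg {Δ : ℚ} (hΔ : Δ < 0) (x : ℍ[ℚ,Δ,-1]) (hx : x ≠ 0) : IsUnit x := by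
  refine QuaternionAlgebra.isUnit_of_normForm_ne_zero x fun h0 => hx ?_
  have h1 : 0 ≤ x.re ^ 2 := sq_nonneg _
  have h2 : 0 ≤ -Δ * x.imI ^ 2 := mul_nonneg (by linarith) (sq_nonneg _)
  have h3 : 0 ≤ x.imJ ^ 2 := sq_nonneg _
  have h4 : 0 ≤ -Δ * x.imK ^ 2 := mul_nonneg (by linarith) (sq_nonneg _)
  have e : x.re ^ 2 - Δ * x.imI ^ 2 - (-1) * x.imJ ^ 2 + Δ * (-1) * x.imK ^ 2 =
      x.re ^ 2 + -Δ * x.imI ^ 2 + x.imJ ^ 2 + -Δ * x.imK ^ 2 := by ring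
  rw [e] at h0
  have hre : x.re ^ 2 = 0 := by linarith
  have hI : -Δ * x.imI ^ 2 = 0 := by linarith
  have hJ : x.imJ ^ 2 = 0 := by linarith
  have hK : -Δ * x.imK ^ 2 = 0 := by linarith
  have hΔ0 : -Δ ≠ 0 := by linarith
  ext
  · exact pow_eq_zero_iff two_ne_zero |>.mp hre
  · exact pow_eq_zero_iff two_ne_zero |>.mp ((mul_eq_zero.mp hI).resolve_left hΔ0)
  · exact pow_eq_zero_iff two_ne_zero |>.mp hJ
  · exact pow_eq_zero_iff two_ne_zero |>.mp ((mul_eq_zero.mp hK).resolve_left hΔ0)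

/-- **The universal model**: `γ = (t + i)/2 ∈ ℍ[ℚ, t² - 4n, -1]` has `trd γ = t`, `nrd γ = n`. [cite: VignerasLNM800, Ch. I §1; Cox2013, §7.A] -/
theorem gammaHyp_model (h : t ^ 2 < 4 * n) :
    haveI : IsQuaternionAlgebra ℚ ℍ[ℚ,((t : ℚ) ^ 2 - 4 * n),-1] :=
      QuaternionAlgebra.isQuaternionAlgebra_holds (by
        have : ((t : ℚ)) ^ 2 - 4 * n < 0 := by exact_mod_cast (by linarith : (t ^ 2 - 4 * n : ℤ) < 0)
        exact this.ne) (by norm_num)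
    GammaHyp (⟨(t : ℚ) / 2, 1 / 2, 0, 0⟩ : ℍ[ℚ,((t : ℚ) ^ 2 - 4 * n),-1]) t n := by
  have hΔ : ((t : ℚ)) ^ 2 - 4 * n < 0 := by exact_mod_cast (by linarith : (t ^ 2 - 4 * n : ℤ) < 0)
  exact
  { hdiv := isUnit_of_ne_zero_of_neg hΔ
    htr := by rw [reducedTrace_quaternionAlgebra]; ring
    hnr := by rw [reducedNorm_quaternionAlgebra]; ring
    hlt := h }

/-- **The conductor step for weighted class numbers** (Cox Thm. 7.24 / Cor. 7.28, one prime at a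
time, with the unit index): for `t² < 4n`, a prime `q` and `fq` a conductor of `(t, n)`,
`h_w((t² - 4n)/f²) = h_w((t² - 4n)/(fq)²) · (q + 1 - ρ_q(t_{fq}, n_{fq}))`. [cite: Cox2013, Thm. 7.24 and Cor. 7.28; VignerasLNM800, Ch. III §5 Cor. 5.12] -/
theorem weightedClassNumber_step (h : t ^ 2 < 4 * n) {f q : ℕ} (hq : q.Prime)
    (hfq : f * q ∈ ellipticConductors t n) :
    weightedClassNumber ((t ^ 2 - 4 * n) / (f : ℤ) ^ 2) =
      weightedClassNumber ((t ^ 2 - 4 * n) / ((f * q : ℕ) : ℤ) ^ 2) *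
        ((q : ℚ) + 1 - rho q (tOf t n (f * q)) (nOf t n (f * q))) := by
  have hΔ : ((t : ℚ)) ^ 2 - 4 * n < 0 := by exact_mod_cast (by linarith : (t ^ 2 - 4 * n : ℤ) < 0)
  haveI : IsQuaternionAlgebra ℚ ℍ[ℚ,((t : ℚ) ^ 2 - 4 * n),-1] :=
    QuaternionAlgebra.isQuaternionAlgebra_holds hΔ.ne (by norm_num)
  exact (gammaHyp_model h).weightedClassNumber_step hq hfq

end Universal

end Brandt

end Literature.NumberTheory.Automorphic

end
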